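import Summits.QuantumFields.BalabanUV.Beta.FP.NestedDeadRowsOrderTwoTowerClosed
import Summits.QuantumFields.BalabanUV.Beta.FP.TorusCompositeObjectsG

/-!
# `BalabanUV.Beta.FP.NestedDeadRowsOrderTwoTowerClosedG` — road «FP» for binder row D1, ROUTE T, (β1) re-basing (R-D1-g52-1 l.56283; R-FP-69 (b) l.56319;
# R-FP-70 l.56383 «the road's #19-G…#21-G are generic over `(Q, K)`, brick-specific kernel inputs DISPLAYED»; leaf-06 g32 W-2 l.56339 item G-5; R-FP-71 FINAL
# l.58350 «DISPLAY WHAT YOU USE» — the road's mock-up ADOPTED): **#21's TWO KKT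
# NON-DEGENERACIES AND ITS CLOSED `uTop`, OVER AN ABSTRACT STEP-ROW FAMILY WITH EVERY KERNEL INPUT DISPLAYED** — the GENERIC twin of
# `FP/NestedDeadRowsOrderTwoTowerClosed` (leaf-06 g28): the finest form `H₀`, the top averaging `Q₂₀` and the coarse form `F₀` are FREE matrices; the four
# kernel facts the rooted proof fetched by name — the OWNER's (WARD-m) `a0`, leaf-02's (COV-m) `c0`, leaf-05's (INV-m) ∧ (EFF-m), leaf-05's top comb-rows KKT
# letter — and this lineage's lower transversality `hSL` are HYPOTHESES, single-instance, in their suppliers' printed shapes; what remains is an2's slice change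
# + the kernel-free one-shot transversality.  NO landed byte moved.

WHAT.  §1 **`torus_kkt_nondeg_towerG`**: for `Q : StepRows d Lc`, at #21's index types: `Q₁₀` FREE (the top composite block), `τ₁ := bigP …` (`hτ₁`, the
one-shot slice), `τ₂` ANY coarse comb rows, `H₀ Q₂₀ F₀ D₀` FREE, and DISPLAYED single-instance (the OWNER d1-p3 g31's RULING R-FP-71 FINAL «DISPLAY WHAT YOU
USE», journal l.58350, W-FP-31-1 FINAL — this file's call shape IS the road's mock-up `ef2d7ed8cdb94e33`, code character for character): `c0 : Q₁₀ * towerGen Lc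
M′ rs (n+1) = fromCols D₀ 0` (leaf-02's (COV-m) order 0 at the top depth, left block free), `hSL : det (nestedSliceG Lc Q (fine Lc M′) … n * towerGen Lc (fine
Lc M′) … n) ≠ 0` (the transversality of the tower BELOW `M′` — `TorusCompositeSliceG`'s conclusion, rooted `TorusCompositeSlice.det_nestedSlice_mul_towerGen_ne_zero`
∕ sym `det_nestedSliceSym_mul_towerGen_ne_zero`), `a0 : H₀ * towerGen Lc M′ rs (n+1) = 0` (#20's `torus_a0_tower` shape), `hH₀t : H₀ᵀ = H₀`, `hInv : (kkt H₀
(fromRows Q₁₀ (nestedSliceG Lc Q (fine Lc M′) … n))).det ≠ 0` and `hEff : (effForm H₀ (fromRows Q₁₀ (nestedSliceG …))).toBlocks₁₁ = c • F₀` (leaf-05's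
`torus_composite_inv_and_eff(_G)` conclusions, `c ≠ 0`), `h2F : IsUnit (kkt F₀ (fromRows Q₂₀ τ₂)).det` (leaf-05's `torus_isUnit_det_kkt_combRows(_comb)` shape)
⊢ `IsUnit (kkt H₀ (fromRows Q₁₀ τ₁)).det ∧ IsUnit (kkt (effForm H₀ (fromRows Q₁₀ τ₁)).toBlocks₁₁ (fromRows Q₂₀ τ₂)).det ∧ (effForm H₀ (fromRows Q₁₀ τ₁)).toBlocks₁₁
= c • F₀` — the rooted proof's lines VERBATIM with the fetches replaced by the hypotheses: an2's `isUnit_det_kkt_sliceChange₃ ∕ blocks_sliceChange₃` across the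
slice change `nestedSliceG ↦ bigP`, transversalities `hSL` and `TorusCompositeUnimodular.det_bigP_mul_towerGen_ne_zero` (kernel-free), the lower generators
killed by `H₀` (`a0`) and by `Q₁₀` (`c0`), `det_kkt_smul_form_ne_zero_iff`.  §2 **`torus_uTop_tower_closedG`**: #21's `uTop` for the nested composite column of
ANY top direction, nothing displayed beyond §1's letters + `hQ₁₀ : Q₁₀ = compRowsG Lc Q M′ lev rs (n+1)` + `hDbar` (`σ′ • D̄`, `σ′ ≠ 0`) + leaf-02's C2 ∕ I-5
covariance images `D̄₁ ∕ D̄₂` along `h` spelled with `compRowsG Lc Q … *ᵥ h` — §1 then the matrix-generic layer `NestedDeadRowsOrderTwo.torus_uTop_of_average_dead_sq`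
+ `NestedColumnCombDeadTower.hdead_of_nested_column_mulVec` (the rooted file went through the `…Tower` spellings; the generic layer is the same proof one `def`
down).  CALL SHAPE: `torus_kkt_nondeg_towerG M' Lc lev rs n Q hrs H₀ hτ₁ τ₂ Q₂₀ D₀ c0 hSL a0 hH₀t hInv hc hEff h2F` (the road's #41d-G v1.1).
INSTANCES (not re-stated — dedup ∕ R-FP-70's consistency `example`s live in the road's -G files): ROOTED = `Q := fun M _ ℓ r => Qstep Lc M ℓ r`, `c0 :=
compRows_mul_towerGen_succ` (`D₀ := σ_{n+1} • D̄`), `hSL := det_nestedSlice_mul_towerGen_ne_zero` (bridge `nestedSlice_eq_nestedSliceG`), `a0 := torus_a0_tower`, `hH₀t := H₀_transpose_of_dvd …`, `hInv ∕ hEff := torus_composite_inv_and_eff`, `h2F :=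
torus_isUnit_det_kkt_combRows …` (through `TorusCompositeObjectsG` §2's bridges); SYM = `Q := QSym Lc` at `rs := fun _ => ctrOff (d+1) Lc` with leaf-02's R-20 sym `c0`,
`hSL := TorusCompositeSliceG.det_nestedSliceSym_mul_towerGen_ne_zero`, the OWNER's `a0`, leaf-05's
`TorusEffFormCompositeG` sym instance and `RelInvPeriodisedCombRecord.torus_isUnit_det_kkt_combRows_comb`.  [folklore] linear algebra BY NAME; no `def`, no
`def … : Prop`, nothing cited, 0 sorry; `synthInstance.maxSize 1024` on the two theorems exactly as in the rooted file (the nested `Sum` index types);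
nothing of the dictionary ∕ Bałaban's asserted (the presentation is the ROW's ruling; every kernel input is its supplier's theorem, displayed).

HONEST DEPENDENCY (page 1, mandatory): continuum YM on T⁴ ⇐ BetaPertH ∧ nine spine estimates (0/9 proved); BetaPertH ⇐ (D1) ∧ (D4) ∧ CAP+tail;
G-an2-4 gates asym, D1 and NE2/3/4.  HONEST FRAMING (cell contract, verbatim): «discharging `BetaPertH` makes Bałaban's UV stability UNCONDITIONAL —
a real constructive-QFT result; it is NOT the continuum limit and NOT the Clay problem.»  ABSOLUTE RULE (cell charter, verbatim): «No internally-minted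
statement may enter as a cited fact. Every hypothesis is either kernel-proved in this package or a verbatim quotation of a PUBLISHED theorem with page
reference. The manuscript(s) under audit are NOT citable for their own disputed steps — they are the thing under adjudication; programme-internal
(2001/route/tribunal) claims are never citable.»  0 estimates; 0∕4 row-D1 binders (hW, hR, D1Tel, D1Rep); NOT (C1), NOT (T-ID)∕(T-β) complete, NOT SDF,
NOT D1, NOT BetaPertH, NOT continuum, NOT Clay.  D1 formalisation swarm LEAF PROVER 06 (b2b-balaban-beta-d1-formalise-leaf-06 gen 32 ∕ gen 34; call shape = the road OWNER d1-p3 g31's mock-up), 2026-08-24.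
No existing file touched.
-/

noncomputable section

open scoped BigOperators Matrix

namespace Summit.QuantumFields.BalabanUV.Beta.FP.NestedDeadRowsOrderTwoTowerClosedG

open Matrix Finset
open Literature.MathematicalPhysics.QuantumFieldTheory.Balaban1983to89
open Literature.MathematicalPhysics.QuantumFieldTheory.Balaban1983to89.Beta
open Literature.MathematicalPhysics.QuantumFieldTheory.Balaban1983to89.Beta.Composition (kkt)
open Literature.MathematicalPhysics.QuantumFieldTheory.Balaban1983to89.Beta.CompositionSingular (effForm minOp)
open Literature.MathematicalPhysics.QuantumFieldTheory.Balaban1983to89.Beta.GaugeFixingPropagators (isUnit_det_kkt_sliceChange₃ blocks_sliceChange₃)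
open B5Prop11Plancherel (fine)
open B6Lemma24Torus (pbox)
open AffineAveraging (Site box toSite unitVec)
open OneStepResolventKernel (Fib)
open Summit.QuantumFields.BalabanUV.Beta.D1BFx.LogDetSecondVariation (secondVar)
open Summit.QuantumFields.BalabanUV.Beta.FP.KernelPeriodisationFib (Idx)
open Summit.QuantumFields.BalabanUV.Beta.FP.TorusCombRows (Res)
open Summit.QuantumFields.BalabanUV.Beta.FP.TorusGaugeCovariance (tgrad tdelta)
open Summit.QuantumFields.BalabanUV.Beta.FP.TorusCompositeObjects (towerTorus NParam combF bigP towerGen)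
open Summit.QuantumFields.BalabanUV.Beta.FP.TorusCompositeObjectsG (StepRows compRowsG nestedSliceG)
open Summit.QuantumFields.BalabanUV.Beta.FP.TorusCompositeUnimodular (det_bigP_mul_towerGen_ne_zero)
open Summit.QuantumFields.BalabanUV.Beta.FP.RelInvPeriodisedCoarse (det_kkt_smul_form_ne_zero_iff)
open Summit.QuantumFields.BalabanUV.Beta.FP.NestedStepLawTorusInstance (dvd_fine)
open Summit.QuantumFields.BalabanUV.Beta.GAN24.FineReadoutCauchyFrame (toSite_mem_range)
open Summit.QuantumFields.BalabanUV.Beta.FP.NestedDeadRowsOrderTwo (torus_uTop_of_average_dead_sq)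
open Summit.QuantumFields.BalabanUV.Beta.FP.NestedColumnCombDeadTower (hdead_of_nested_column_mulVec)

variable {d : ℕ} (M' : Fin (d + 1) → ℕ) [∀ μ, NeZero (M' μ)] (Lc : ℕ) [NeZero Lc] (lev : ℕ → ℕ) (rs : ℕ → (Fin (d + 1) → ℕ)) (n : ℕ)
  (Q : StepRows d Lc)

/-! ## §1 #21's two KKT non-degeneracies over `Q`, every kernel input displayed -/

set_option synthInstance.maxSize 1024 in
/-- [folklore] **`torus_kkt_nondeg_towerG` — #21's INTERNAL `h1` AND `h2` + the (EFF-m) identity, FOR ANY STEP-ROW FAMILY `Q`, the top block `Q₁₀`, the finest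
form `H₀`, the top averaging `Q₂₀`, the coarse form `F₀` and the descended modes `D₀` FREE, and the kernel facts DISPLAYED single-instance (R-FP-71 FINAL)**: `c0`
((COV-m) order 0 at the top depth: `Q₁₀ * W₀ = fromCols D₀ 0`), `hSL` (the tower below `M′` is transversal to the tower generators: `TorusCompositeSliceG`'s
conclusion), `a0` ((WARD-m) order 0: `H₀` kills the tower's generators), `hH₀t` (`H₀` symmetric), `hInv ∕ hEff` ((INV-m) ∧ (EFF-m) on the NESTED slice: KKT
non-degenerate, effective coarse form `= c • F₀`, `c ≠ 0`), `h2F` (the top system `(F₀, [Q₂₀; τ₂])` KKT-non-degenerate) ⊢ the ONE-SHOT-slice system `(H₀, [Q₁₀; τ₁])` is KKT-non-degenerate, so is `((effForm …).toBlocks₁₁,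
[Q₂₀; τ₂])`, and the effective form on the one-shot slice IS `c • F₀` — an2's slice change across `nestedSliceG ↦ bigP` with the transversalities
`hSL` ∕ `det_bigP_mul_towerGen_ne_zero`, the lower generators killed by `H₀` (`a0`) and by `Q₁₀` (`c0`).
(`Lc ∣ M′ i` is NOT a binder here: in the rooted proof it entered only through the top comb-rows letter, now displayed as `h2F`, and through `dvd_fine` below the top.) -/
theorem torus_kkt_nondeg_towerG (hrs : ∀ k, rs k ∈ box (d + 1) Lc)
    {κ : Type*} [Fintype κ] [DecidableEq κ]
    (H₀ : Matrix (↥(pbox (towerTorus Lc M' (n + 1))) × Fin (d + 1)) (↥(pbox (towerTorus Lc M' (n + 1))) × Fin (d + 1)) ℝ)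
    {Q₁₀ : Matrix (↥(pbox M') × Fin (d + 1)) (↥(pbox (towerTorus Lc M' (n + 1))) × Fin (d + 1)) ℝ}
    {τ₁ : Matrix (NParam Lc (fine Lc M') (fun k => rs (k + 1)) n) (↥(pbox (towerTorus Lc M' (n + 1))) × Fin (d + 1)) ℝ}
    (hτ₁ : τ₁ = bigP Lc (fine Lc M') (fun k => rs (k + 1)) (fun k => toSite_mem_range (hrs (k + 1))) n)
    (τ₂ : Matrix (Res (toSite (rs 0)) Lc M') (↥(pbox M') × Fin (d + 1)) ℝ) (Q₂₀ : Matrix κ (↥(pbox M') × Fin (d + 1)) ℝ)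
    -- R-FP-71 FINAL «display what you use»: leaf-02's (COV-m) ORDER 0 AT THE TOP DEPTH (left block `D₀` free) and the transversality of the tower
    -- BELOW `M′` (this lineage's `hTW^{(n)}` conclusion), DISPLAYED single-instance — no covariance family
    (D₀ : Matrix (↥(pbox M') × Fin (d + 1)) (Res (toSite (rs 0)) Lc M') ℝ)
    (c0 : Q₁₀ * towerGen Lc M' rs (n + 1) = Matrix.fromCols D₀ (0 : Matrix (↥(pbox M') × Fin (d + 1)) (NParam Lc (fine Lc M') (fun k => rs (k + 1)) n) ℝ))
    (hSL : (nestedSliceG Lc Q (fine Lc M') (fun k => lev (k + 1)) (fun k => rs (k + 1)) n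
        * towerGen Lc (fine Lc M') (fun k => rs (k + 1)) n).det ≠ 0)
    (a0 : H₀ * towerGen Lc M' rs (n + 1) = 0) (hH₀t : H₀ᵀ = H₀)
    (hInv : (kkt H₀ (fromRows Q₁₀ (nestedSliceG Lc Q (fine Lc M') (fun k => lev (k + 1)) (fun k => rs (k + 1)) n))).det ≠ 0)
    {c : ℝ} (hc : c ≠ 0) {F₀ : Matrix (↥(pbox M') × Fin (d + 1)) (↥(pbox M') × Fin (d + 1)) ℝ}
    (hEff : (effForm H₀ (fromRows Q₁₀ (nestedSliceG Lc Q (fine Lc M') (fun k => lev (k + 1)) (fun k => rs (k + 1)) n))).toBlocks₁₁ = c • F₀)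
    (h2F : IsUnit (kkt F₀ (fromRows Q₂₀ τ₂)).det) :
    IsUnit (kkt H₀ (fromRows Q₁₀ τ₁)).det ∧ IsUnit (kkt (effForm H₀ (fromRows Q₁₀ τ₁)).toBlocks₁₁ (fromRows Q₂₀ τ₂)).det
      ∧ (effForm H₀ (fromRows Q₁₀ τ₁)).toBlocks₁₁ = c • F₀ := by
  -- the tower's generators (the door's `W₀`): killed by `H₀` (`a0`) and by `Q₁₀` up to the top block (`c0`, displayed)
  obtain ⟨W₀, hW₀⟩ : ∃ W₀ : Matrix (↥(pbox (towerTorus Lc M' (n + 1))) × Fin (d + 1)) (NParam Lc M' rs (n + 1)) ℝ, W₀ = towerGen Lc M' rs (n + 1) := ⟨_, rfl⟩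
  have a0' : H₀ * W₀ = 0 := by rw [hW₀]; exact a0
  have c0' : Q₁₀ * W₀ = fromCols D₀ (0 : Matrix (↥(pbox M') × Fin (d + 1)) (NParam Lc (fine Lc M') (fun k => rs (k + 1)) n) ℝ) := by
    rw [hW₀]; exact c0
  -- the NESTED slice and the LOWER generators, NAMED at the call's index types
  obtain ⟨τn, hτn⟩ : ∃ τn : Matrix (NParam Lc (fine Lc M') (fun k => rs (k + 1)) n) (↥(pbox (towerTorus Lc M' (n + 1))) × Fin (d + 1)) ℝ,
      τn = nestedSliceG Lc Q (fine Lc M') (fun k => lev (k + 1)) (fun k => rs (k + 1)) n := ⟨_, rfl⟩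
  obtain ⟨Wl, hWl⟩ : ∃ Wl : Matrix (↥(pbox (towerTorus Lc M' (n + 1))) × Fin (d + 1)) (NParam Lc (fine Lc M') (fun k => rs (k + 1)) n) ℝ,
      Wl = towerGen Lc (fine Lc M') (fun k => rs (k + 1)) n := ⟨_, rfl⟩
  have hW2 : W₀.toCols₂ = Wl := by
    rw [hWl, hW₀]
    exact Matrix.toCols₂_fromCols _ _
  have hKW : H₀ * Wl = 0 := by
    have h0 : H₀ * Matrix.fromCols W₀.toCols₁ W₀.toCols₂ = 0 := by rw [Matrix.fromCols_toCols]; exact a0'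
    rw [Matrix.mul_fromCols, ← Matrix.fromCols_zero] at h0
    rw [← hW2]
    exact (Matrix.fromCols_inj h0).2
  have hKtW : H₀ᵀ * Wl = 0 := by rw [hH₀t]; exact hKW
  have hQW : Q₁₀ * Wl = 0 := by
    have h0 : Q₁₀ * Matrix.fromCols W₀.toCols₁ W₀.toCols₂
        = Matrix.fromCols D₀ (0 : Matrix (↥(pbox M') × Fin (d + 1)) (NParam Lc (fine Lc M') (fun k => rs (k + 1)) n) ℝ) := by
      rw [Matrix.fromCols_toCols]; exact c0'
    rw [Matrix.mul_fromCols] at h0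
    rw [← hW2]
    exact (Matrix.fromCols_inj h0).2
  -- transversal to both slices
  have hT : (τn * Wl).det ≠ 0 := by
    rw [hτn, hWl]
    exact hSL
  have hSW : (τ₁ * Wl).det ≠ 0 := by
    rw [hτ₁, hWl]
    exact det_bigP_mul_towerGen_ne_zero Lc (fine Lc M') (fun k => rs (k + 1)) (fun k => toSite_mem_range (hrs (k + 1))) (dvd_fine M') n
  -- (INV) on the nested slice, displayed
  have hτn1 : (kkt H₀ (fromRows Q₁₀ τn)).det ≠ 0 := by rw [hτn]; exact hInv
  -- (INV) ∧ (EFF) ACROSS THE SLICE CHANGE (an2's Literature `GaugeFixingPropagators` §3c)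
  have h1 : IsUnit (kkt H₀ (fromRows Q₁₀ τ₁)).det :=
    isUnit_det_kkt_sliceChange₃ H₀ Q₁₀ τn τ₁ Wl hKW hKtW hQW (isUnit_iff_ne_zero.2 hT) (isUnit_iff_ne_zero.2 hSW)
      (isUnit_iff_ne_zero.2 hτn1)
  have hEff1 : (effForm H₀ (fromRows Q₁₀ τ₁)).toBlocks₁₁ = (effForm H₀ (fromRows Q₁₀ τn)).toBlocks₁₁ := by
    rw [(blocks_sliceChange₃ H₀ Q₁₀ τn τ₁ Wl hKW hKtW hQW (isUnit_iff_ne_zero.2 hT) (isUnit_iff_ne_zero.2 hSW)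
      (isUnit_iff_ne_zero.2 hτn1)).2.2.2, toBlocks_fromBlocks₁₁]
  have hEff' : (effForm H₀ (fromRows Q₁₀ τ₁)).toBlocks₁₁ = c • F₀ := by rw [hEff1, hτn]; exact hEff
  have h2 : (kkt (effForm H₀ (fromRows Q₁₀ τ₁)).toBlocks₁₁ (fromRows Q₂₀ τ₂)).det ≠ 0 := by
    rw [hEff', det_kkt_smul_form_ne_zero_iff hc]
    exact h2F.ne_zero
  exact ⟨h1, isUnit_iff_ne_zero.2 h2, hEff'⟩

/-! ## §2 #21's `uTop` slot CLOSED over `Q`: nothing beyond §1's letters -/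

set_option synthInstance.maxSize 1024 in
/-- [folklore] **`torus_uTop_tower_closedG` — #21's `uTop` FOR THE NESTED COMPOSITE COLUMN OF ANY TOP DIRECTION, OVER `Q`, NOTHING DISPLAYED BEYOND §1's LETTERS.**
With §1's data + `hQ₁₀ : Q₁₀ = compRowsG Lc Q M′ lev rs (n+1)`, the top comb rows `τ₂ := combF Lc M′ (rs 0)` (`hτ₂`), `hDbar : Dbar = σ′ • D̄` (`σ′ ≠ 0`), and leaf-02's C2 ∕ I-5 composite covariance images `D̄₁ ∕
D̄₂` along `h` spelled over `compRowsG Lc Q … *ᵥ h` (their letters' shapes, `κ := c² · σ′⁻¹`): for every top direction `h̄`, with `h :=` the nested composite column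
`minOp H₀ [Q₁₀; τ₁]·(minOp (effForm H₀ [Q₁₀; τ₁])₁₁ [Q₂₀; τ₂]·(h̄, 0), 0)`, `secondVar (τ₂ * Dbar) (τ₂ * Db₁) (τ₂ * Db₂) = 0` — §1 for `h₁ h₂`, then the
matrix-generic layer `NestedDeadRowsOrderTwo.torus_uTop_of_average_dead_sq` + `NestedColumnCombDeadTower.hdead_of_nested_column_mulVec`. -/
theorem torus_uTop_tower_closedG (hrs : ∀ k, rs k ∈ box (d + 1) Lc) (hM' : ∀ i, Lc ∣ M' i)
    {κ : Type*} [Fintype κ] [DecidableEq κ]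
    (H₀ : Matrix (↥(pbox (towerTorus Lc M' (n + 1))) × Fin (d + 1)) (↥(pbox (towerTorus Lc M' (n + 1))) × Fin (d + 1)) ℝ)
    {Q₁₀ : Matrix (↥(pbox M') × Fin (d + 1)) (↥(pbox (towerTorus Lc M' (n + 1))) × Fin (d + 1)) ℝ}
    {τ₁ : Matrix (NParam Lc (fine Lc M') (fun k => rs (k + 1)) n) (↥(pbox (towerTorus Lc M' (n + 1))) × Fin (d + 1)) ℝ}
    (hQ₁₀ : Q₁₀ = compRowsG Lc Q M' lev rs (n + 1))
    (hτ₁ : τ₁ = bigP Lc (fine Lc M') (fun k => rs (k + 1)) (fun k => toSite_mem_range (hrs (k + 1))) n)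
    {τ₂ : Matrix (Res (toSite (rs 0)) Lc M') (↥(pbox M') × Fin (d + 1)) ℝ} (hτ₂ : τ₂ = combF Lc M' (rs 0))
    (Q₂₀ : Matrix κ (↥(pbox M') × Fin (d + 1)) ℝ)
    -- R-FP-71 FINAL «display what you use»: leaf-02's (COV-m) ORDER 0 AT THE TOP DEPTH (left block `D₀` free) and the transversality of the tower
    -- BELOW `M′` (this lineage's `hTW^{(n)}` conclusion), DISPLAYED single-instance — no covariance family
    (D₀ : Matrix (↥(pbox M') × Fin (d + 1)) (Res (toSite (rs 0)) Lc M') ℝ)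
    (c0 : Q₁₀ * towerGen Lc M' rs (n + 1) = Matrix.fromCols D₀ (0 : Matrix (↥(pbox M') × Fin (d + 1)) (NParam Lc (fine Lc M') (fun k => rs (k + 1)) n) ℝ))
    (hSL : (nestedSliceG Lc Q (fine Lc M') (fun k => lev (k + 1)) (fun k => rs (k + 1)) n
        * towerGen Lc (fine Lc M') (fun k => rs (k + 1)) n).det ≠ 0)
    (a0 : H₀ * towerGen Lc M' rs (n + 1) = 0) (hH₀t : H₀ᵀ = H₀)
    (hInv : (kkt H₀ (fromRows Q₁₀ (nestedSliceG Lc Q (fine Lc M') (fun k => lev (k + 1)) (fun k => rs (k + 1)) n))).det ≠ 0)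
    {c : ℝ} (hc : c ≠ 0) {F₀ : Matrix (↥(pbox M') × Fin (d + 1)) (↥(pbox M') × Fin (d + 1)) ℝ}
    (hEff : (effForm H₀ (fromRows Q₁₀ (nestedSliceG Lc Q (fine Lc M') (fun k => lev (k + 1)) (fun k => rs (k + 1)) n))).toBlocks₁₁ = c • F₀)
    (h2F : IsUnit (kkt F₀ (fromRows Q₂₀ τ₂)).det)
    {σ' : ℝ} (hσ' : σ' ≠ 0)
    {Dbar : Matrix (↥(pbox M') × Fin (d + 1)) (Res (toSite (rs 0)) Lc M') ℝ}
    (hDbar : Dbar = σ' • (tgrad M').submatrix (fun a : ↥(pbox M') × Fin (d + 1) => ((a.1, Sum.inl a.2) : Idx M' (Fib d)))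
        (fun t : Res (toSite (rs 0)) Lc M' => (t.1 : ↥(pbox M'))))
    (hbar : κ → ℝ)
    {v : ↥(pbox M') × Fin (d + 1) → ℝ} (hv : v = minOp (effForm H₀ (fromRows Q₁₀ τ₁)).toBlocks₁₁ (fromRows Q₂₀ τ₂) *ᵥ Sum.elim hbar 0)
    {h : ↥(pbox (towerTorus Lc M' (n + 1))) × Fin (d + 1) → ℝ} (hh : h = minOp H₀ (fromRows Q₁₀ τ₁) *ᵥ Sum.elim v 0)
    (cc : ℝ)
    {Db₁ : Matrix (↥(pbox M') × Fin (d + 1)) (Res (toSite (rs 0)) Lc M') ℝ}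
    (hDb₁ : Db₁ = Matrix.of fun (a : ↥(pbox M') × Fin (d + 1)) (t : Res (toSite (rs 0)) Lc M') =>
        -(cc * (compRowsG Lc Q M' lev rs (n + 1) *ᵥ h) a * tdelta M' ((a.1 : Site (d + 1)) + unitVec a.2) t.1))
    {Db₂ : Matrix (↥(pbox M') × Fin (d + 1)) (Res (toSite (rs 0)) Lc M') ℝ}
    (hDb₂ : Db₂ = Matrix.of fun (a : ↥(pbox M') × Fin (d + 1)) (t : Res (toSite (rs 0)) Lc M') =>
        (cc ^ 2 * σ'⁻¹) * ((compRowsG Lc Q M' lev rs (n + 1) *ᵥ h) a) ^ 2 * tdelta M' ((a.1 : Site (d + 1)) + unitVec a.2) t.1) :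
    secondVar (τ₂ * Dbar) (τ₂ * Db₁) (τ₂ * Db₂) = 0 := by
  obtain ⟨h₁, h₂, -⟩ := torus_kkt_nondeg_towerG M' Lc lev rs n Q hrs H₀ hτ₁ τ₂ Q₂₀ D₀ c0 hSL a0 hH₀t hInv hc hEff h2F
  subst hQ₁₀
  exact torus_uTop_of_average_dead_sq M' (hrs 0) hM' hτ₂ hσ' hDbar Db₁ Db₂ (compRowsG Lc Q M' lev rs (n + 1)) h cc (fun _ => cc ^ 2 * σ'⁻¹)
    (fun a _ t => by rw [hDb₁]; rfl) (fun a _ t => by rw [hDb₂]; rfl)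
    (hdead_of_nested_column_mulVec M' (toSite (rs 0)) H₀ (compRowsG Lc Q M' lev rs (n + 1)) τ₁ (effForm H₀ (fromRows _ τ₁)).toBlocks₁₁ Q₂₀ hτ₂ h₁ h₂
      hbar hv hh)

end Summit.QuantumFields.BalabanUV.Beta.FP.NestedDeadRowsOrderTwoTowerClosedG

end
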